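import Mathlib
import HarnessLib
import Literature.Analysis.FluidPDE.LinearizedNSTorus
import Literature.Analysis.FluidPDE.TwoHalfNavierStokes

/-!
# Stub `stub_columnarOfPlanar` of the line `Sketch` (crux stmt-AnomalousDissipation-10430,
# `ImpulseGrid.BoundedEnergyGrid`): planar steady branch ⇒ columnar steady branch (axis `2`)

Registered signature (proved here, textually; `𝕋³ = UnitAddTorus (Fin 3)`,
`E³ = EuclideanSpace ℝ (Fin 3)`, `𝕋² = UnitAddTorus (Fin 2)`, `E² = EuclideanSpace ℝ (Fin 2)` are
the skeleton's local notations, redeclared below):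
```
theorem stub_columnarOfPlanar :
    (∃ g : 𝕋² → E², IsSmooth g ∧ IsDivFree g ∧ HasZeroMean g ∧ g ≠ 0 ∧
      ∃ (ν : ℕ → ℝ) (v : ℕ → 𝕋² → E²) (p : ℕ → 𝕋² → ℝ),
        (∀ j, 0 < ν j) ∧ Tendsto ν atTop (𝓝 0) ∧
        (∀ j, IsSteadyNSState (ν j) g (v j) (p j)) ∧
        (∀ j, HasZeroMean (v j)) ∧
        ∃ E : ℝ, ∀ j, ∫ x, ‖v j x‖ ^ 2 ≤ E) →
    ∃ G : 𝕋³ → E³, IsSmooth G ∧ (∀ (s : UnitAddCircle) x, G (x + Pi.single (2 : Fin 3) s) = G x) ∧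
      (∀ x, G x 2 = 0) ∧ IsDivFree G ∧ HasZeroMean G ∧ G ≠ 0 ∧
      ∃ (ν : ℕ → ℝ) (V : ℕ → 𝕋³ → E³) (p : ℕ → 𝕋³ → ℝ),
        (∀ j, 0 < ν j) ∧ Tendsto ν atTop (𝓝 0) ∧
        (∀ j, IsSteadyNSState (ν j) G (V j) (p j)) ∧
        (∀ j (s : UnitAddCircle) x, V j (x + Pi.single (2 : Fin 3) s) = V j x) ∧
        (∀ j x, V j x 2 = 0) ∧ (∀ j, HasZeroMean (V j)) ∧
        ∃ E : ℝ, ∀ j, ∫ x, ‖V j x‖ ^ 2 ≤ E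
```

The `2½`-dimensional lift with ZERO vertical component (Majda–Bertozzi 2002, §2.3.1; in tree
`Torus.twoHalf`, `Torus.isClassicalNSSolutionOn_twoHalf`): a planar branch `(g, ν_j, v_j, p_j, E)`
gives `G := twoHalf g 0`, `V_j := twoHalf (v_j) 0`, pressures `p_j ∘ planarProj`, the same `ν_j`
and the same energy bound `E` (`∫‖(v,0)∘π‖² = ∫‖v‖²`, `Torus.integral_norm_sq_twoHalf`). Steadiness:
`isClassicalNSSolutionOn_twoHalf` on `univ` with the constant-in-time data `V = v_j`, `R = 0`,
`φ = p_j` produces a classical solution whose force `twoHalfForce univ ν_j v_j 0 p_j` equals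
`twoHalf g 0` by the planar steady momentum equation (the time derivative of a constant path, the
gradient and the Laplacian of the zero scalar all vanish). Invariance along the axis `2` is
`Torus.comp_planarProj_add_single`, the vanishing component is `Torus.twoHalf_apply_two`, zero
mean is `Torus.hasZeroMean_twoHalf`, and `twoHalf g 0 ≠ 0` because `planarProj` is onto
(`planarProj (Fin.snoc y 0) = y`). Pure proof file (no definitions).
-/

-- `Summit.<Summit>.<Problem>` is the tree's mandated summit-side namespace (CONVENTIONS §2); for this
-- single-conjunct summit the two coincide, so the duplicate is deliberate.
set_option linter.dupNamespace false

noncomputable section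

namespace Summit.AnomalousDissipation.AnomalousDissipation.Theorems

open MeasureTheory Filter Topology Set
open Literature.Analysis.FunctionSpaces Literature.Analysis.FunctionSpaces.Torus
open Literature.Analysis.FluidPDE Literature.Analysis.FluidPDE.Torus

/-- The flat three-torus (local notation, as in the registered skeleton). -/
local notation "𝕋³" => UnitAddTorus (Fin 3)
/-- Velocity values on `T³` (local notation, as in the registered skeleton). -/
local notation "E³" => EuclideanSpace ℝ (Fin 3)
/-- The flat two-torus (local notation, as in the registered skeleton). -/
local notation "𝕋²" => UnitAddTorus (Fin 2)
/-- Planar velocity values (local notation, as in the registered skeleton). -/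
local notation "E²" => EuclideanSpace ℝ (Fin 2)

/-! ## Calculus trivia on `T²` -/

/-- The gradient of the zero scalar on `T²` vanishes. [folklore] -/
theorem columnarOfPlanar_gradient_zero (y : 𝕋²) : Torus.gradient (0 : 𝕋² → ℝ) y = 0 := by
  unfold Torus.gradient Torus.liftAt
  simp [_root_.gradient]

/-- The Laplacian of the zero scalar on `T²` vanishes. [folklore] -/
theorem columnarOfPlanar_laplacian_zero (y : 𝕋²) : Torus.laplacian (0 : 𝕋² → ℝ) y = 0 := by
  unfold Torus.laplacian Torus.liftAt
  simp

/-- The one-sided time derivative of a constant path vanishes. [folklore] -/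
theorem columnarOfPlanar_timeDerivWithin_const {F : Type*} [NormedAddCommGroup F] [NormedSpace ℝ F]
    (S : Set ℝ) (w : 𝕋² → F) (t : ℝ) (y : 𝕋²) :
    Torus.timeDerivWithin S (fun _ : ℝ => w) t y = 0 := by
  simp [Torus.timeDerivWithin]

/-! ## `2½`-dimensional lifts with zero vertical component -/

/-- `2½`-dimensional fields are invariant under translations along the axis `2`
(`Torus.comp_planarProj_add_single`, `Fin.last 2 = 2`). [folklore] -/
theorem columnarOfPlanar_twoHalf_add_single (V : 𝕋² → E²) (R : 𝕋² → ℝ) (s : UnitAddCircle)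
    (x : 𝕋³) : twoHalf V R (x + Pi.single (2 : Fin 3) s) = twoHalf V R x :=
  comp_planarProj_add_single (fun y => planarEmbed (V y, R y)) s x

/-- The planar projection is onto: `planarProj (y₀, y₁, 0) = y`. [folklore] -/
theorem columnarOfPlanar_planarProj_snoc (y : 𝕋²) :
    planarProj (Fin.snoc (α := fun _ => UnitAddCircle) y 0 : 𝕋³) = y := by
  funext i
  simp [planarProj_apply]

/-- A horizontal `2½`-dimensional field `(V, 0) ∘ π` vanishes only if `V` does. [folklore] -/
theorem columnarOfPlanar_twoHalf_ne_zero {V : 𝕋² → E²} (hV : V ≠ 0) : twoHalf V 0 ≠ 0 := by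
  intro h0
  apply hV
  funext y
  ext j
  have h := congrFun h0 (Fin.snoc (α := fun _ => UnitAddCircle) y 0)
  have hj := congrArg (fun w : E³ => w (Fin.castSucc j)) h
  simp only [twoHalf_apply_castSucc, columnarOfPlanar_planarProj_snoc, Pi.zero_apply,
    PiLp.zero_apply] at hj
  rw [hj, Pi.zero_apply, PiLp.zero_apply]

/-- **Steady planar states lift to steady columnar states.** If `v` is a steady state of
`NS_ν(g)` on `T²` with pressure `p`, then `(v, 0) ∘ π` is a steady state of `NS_ν((g, 0) ∘ π)` on
`T³` with pressure `p ∘ π` (`Torus.isClassicalNSSolutionOn_twoHalf` with `R = 0`, `φ = p`; its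
force `twoHalfForce univ ν v 0 p` is `(∂ₜv + (v·∇)v - νΔv + ∇p, 0) ∘ π = (g, 0) ∘ π` by the planar
steady momentum equation; Majda–Bertozzi 2002, §2.3.1). [folklore] -/
theorem columnarOfPlanar_isSteadyNSState_twoHalf {ν : ℝ} {g v : 𝕋² → E²} {p : 𝕋² → ℝ}
    (h : IsSteadyNSState ν g v p) :
    IsSteadyNSState ν (twoHalf g 0) (twoHalf v 0) (p ∘ planarProj) := by
  have hvs : IsSmooth v := h.smooth_velocity.isSmooth_slice (mem_univ (0 : ℝ))
  have hps : IsSmooth p := h.smooth_pressure.isSmooth_slice (mem_univ (0 : ℝ))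
  have hz : IsSmooth (0 : 𝕋² → ℝ) := isSmooth_const (0 : ℝ)
  have hcl := isClassicalNSSolutionOn_twoHalf uniqueDiffOn_univ ν (V := fun _ => v)
    (R := fun _ => (0 : 𝕋² → ℝ)) (φ := fun _ => p) (isSmoothSpaceTimeOn_const hvs _)
    (isSmoothSpaceTimeOn_const hz _) (isSmoothSpaceTimeOn_const hps _)
    (fun t _ => h.divFree t (mem_univ t))
  have hforce : ∀ t (x : 𝕋³),
      twoHalfForce univ ν (fun _ => v) (fun _ => (0 : 𝕋² → ℝ)) (fun _ => p) t x = twoHalf g 0 x := by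
    intro t x
    rw [twoHalfForce_apply]
    congr 1
    · funext y
      have hm := h.momentum t (mem_univ t) y
      rw [columnarOfPlanar_timeDerivWithin_const, zero_add] at hm ⊢
      rw [hm]
      abel
    · funext y
      rw [columnarOfPlanar_timeDerivWithin_const, columnarOfPlanar_gradient_zero,
        columnarOfPlanar_laplacian_zero, inner_zero_right, mul_zero, Pi.zero_apply]
      ring
  exact
    { smooth_velocity := hcl.smooth_velocity
      smooth_pressure := hcl.smooth_pressure
      momentum := fun t ht x => by
        rw [← hforce t x]
        exact hcl.momentum t ht x
      divFree := hcl.divFree }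

/-- **The registered stub `stub_columnarOfPlanar`**: the planar bounded steady branch at zero
momentum lifts to the columnar bounded steady branch on `T³`, invariant along the axis `2` and with
vanishing component `2` (`G := twoHalf g 0`, `V_j := twoHalf (v_j) 0`, `p_j ∘ planarProj`, same
`ν_j`, same `E`). [folklore] -/
theorem stub_columnarOfPlanar :
    (∃ g : 𝕋² → E², IsSmooth g ∧ IsDivFree g ∧ HasZeroMean g ∧ g ≠ 0 ∧
      ∃ (ν : ℕ → ℝ) (v : ℕ → 𝕋² → E²) (p : ℕ → 𝕋² → ℝ),
        (∀ j, 0 < ν j) ∧ Tendsto ν atTop (𝓝 0) ∧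
        (∀ j, IsSteadyNSState (ν j) g (v j) (p j)) ∧
        (∀ j, HasZeroMean (v j)) ∧
        ∃ E : ℝ, ∀ j, ∫ x, ‖v j x‖ ^ 2 ≤ E) →
    ∃ G : 𝕋³ → E³, IsSmooth G ∧ (∀ (s : UnitAddCircle) x, G (x + Pi.single (2 : Fin 3) s) = G x) ∧
      (∀ x, G x 2 = 0) ∧ IsDivFree G ∧ HasZeroMean G ∧ G ≠ 0 ∧
      ∃ (ν : ℕ → ℝ) (V : ℕ → 𝕋³ → E³) (p : ℕ → 𝕋³ → ℝ),
        (∀ j, 0 < ν j) ∧ Tendsto ν atTop (𝓝 0) ∧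
        (∀ j, IsSteadyNSState (ν j) G (V j) (p j)) ∧
        (∀ j (s : UnitAddCircle) x, V j (x + Pi.single (2 : Fin 3) s) = V j x) ∧
        (∀ j x, V j x 2 = 0) ∧ (∀ j, HasZeroMean (V j)) ∧
        ∃ E : ℝ, ∀ j, ∫ x, ‖V j x‖ ^ 2 ≤ E := by
  rintro ⟨g, hg, hgdiv, hgmean, hgne, ν, v, p, hν, hν0, h, hvmean, E, hE⟩
  have hvs : ∀ j, IsSmooth (v j) := fun j =>
    (h j).smooth_velocity.isSmooth_slice (mem_univ (0 : ℝ))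
  have hzmean : HasZeroMean (0 : 𝕋² → ℝ) := by
    simp [HasZeroMean]
  have hzi : Integrable (0 : 𝕋² → ℝ) volume := integrable_zero _ _ _
  refine ⟨twoHalf g 0, hg.twoHalf (isSmooth_const (0 : ℝ)),
    fun s x => columnarOfPlanar_twoHalf_add_single g 0 s x, fun x => ?_, hgdiv.twoHalf 0,
    hasZeroMean_twoHalf hg.integrable hzi hgmean hzmean, columnarOfPlanar_twoHalf_ne_zero hgne,
    ν, fun j => twoHalf (v j) 0, fun j => p j ∘ planarProj, hν, hν0,
    fun j => columnarOfPlanar_isSteadyNSState_twoHalf (h j),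
    fun j s x => columnarOfPlanar_twoHalf_add_single (v j) 0 s x, fun j x => ?_,
    fun j => hasZeroMean_twoHalf (hvs j).integrable hzi (hvmean j) hzmean, E, fun j => ?_⟩
  · rw [twoHalf_apply_two, Pi.zero_apply]
  · rw [twoHalf_apply_two, Pi.zero_apply]
  · show ∫ x, ‖twoHalf (v j) 0 x‖ ^ 2 ≤ E
    rw [integral_norm_sq_twoHalf (hvs j).continuous continuous_zero]
    simpa using hE j

end Summit.AnomalousDissipation.AnomalousDissipation.Theorems

end
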